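import Mathlib
import Summits.AtomisticToContinuum.HydrodynamicLimit.Theorems.ImplosionDichotomyDenseExcursionSonicCentreContentInnerMain
import Summits.AtomisticToContinuum.HydrodynamicLimit.Theorems.ImplosionDichotomyDenseExcursionSonicCentreContentRealThree
import Summits.AtomisticToContinuum.HydrodynamicLimit.Theorems.ImplosionDichotomyDenseExcursionSonicCentreContentGlue

/-!
# `centreContent_of_tube` modulo the bulk amplitude ratio (the exact reduction, in Lean)
# (crux `DenseExcursion`, line `sonic-cavity-renewal`, brick for `centreContent_of_tube`)

Helper file (`--supports stmt-AtomisticToContinuum-12586`, line lead a2, stub-worker W3 for `centreContent_of_tube`).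

The registered helper `centreContent_of_tube` (window → `IsMonatomicProfile` → `OrigProfileEqs` → `CavityTube` →
`CentreContent`) follows from THREE landed bricks and ONE remaining analytic input:
* `realBound_three` (…RealThree): modes have `Re Λ ≤ 3`;
* `centre_inner_standing_wave` (…InnerMain): `‖ŵ − 3ŝ‖ ≤ 2‖ŵ + 3ŝ‖` at the inner matching point `log(1/100)` (`‖Λ‖ ≥ 1000`);
* `centreContent_of_bulk_ratio` (…Glue): `‖m(x_m)‖ ≤ 140‖p(x_m)‖` for the modes of the half-strip ⟹ `CentreContent`;
* REMAINING (registered sub-stub `bulk_ratio_of_tube`): the BULK TRANSPORT on `[log(1/100), −7/10]` —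
  `‖m‖ ≤ 2‖p‖` at `log(1/100)` ⟹ `‖m‖ ≤ 140‖p‖` at `x_m = −7/10` — by the weighted Levinson lemma (`…Levinson`, landed) in the
  `+` gauge (`mode_levinson_form_plus`, landed) with the tube bounds on the bulk (growth `e^{∫ Re q} ≤ 10–16`, coupling
  `∫ κ/|q| = O(1/(ρ₀|Im Λ|))`).
This file records the composition `centreContent_of_tube_of_bulk_ratio` (registered helper) so that landing
`bulk_ratio_of_tube` closes `centreContent_of_tube` by a one-line application.
-/

noncomputable section

open Set

namespace Summit.AtomisticToContinuum.HydrodynamicLimit.Theorems.SonicCavityRenewal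

open Summit.AtomisticToContinuum.HydrodynamicLimit.Theorems.R2OneModeTwoConditions

/-- **Registered helper `centreContent_of_tube_of_bulk_ratio`: THE REDUCTION OF `centreContent_of_tube` TO THE BULK AMPLITUDE
RATIO.** If the bulk transport holds (for every smooth radial mode of a tube profile on the pinned window with
`−1/4 < Re Λ ≤ 3`, `|Im Λ| > boxTop`: `‖m‖ ≤ 2‖p‖` at `log(1/100)` implies `‖m‖ ≤ 140‖p‖` at `matchPoint`), then
`centreContent_of_tube` holds verbatim: `Re Λ ≤ 3` by `realBound_three`, `‖Λ‖ ≥ |Im Λ| > 1000`, the inner standing wave by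
`centre_inner_standing_wave`, and `CentreContent` by `centreContent_of_bulk_ratio`. [folklore] -/
theorem centreContent_of_tube_of_bulk_ratio : (∀ (r : ℝ) (W S : ℝ → ℝ) (Λ : ℂ) (ŵ ŝ : ℝ → ℂ), 17307 / 15625 ≤ r → r ≤ 89409 / 80000 → IsMonatomicProfile r W S → CavityTube r W S → IsSmoothRadialMode r W S Λ ŵ ŝ → -(1 / 4 : ℝ) < Λ.re → Λ.re ≤ 3 → boxTop < |Λ.im| → ‖ŵ (Real.log (1 / 100)) - 3 * ŝ (Real.log (1 / 100))‖ ≤ 2 * ‖ŵ (Real.log (1 / 100)) + 3 * ŝ (Real.log (1 / 100))‖ → ‖ŵ matchPoint - 3 * ŝ matchPoint‖ ≤ 140 * ‖ŵ matchPoint + 3 * ŝ matchPoint‖) → ∀ (r : ℝ) (W S : ℝ → ℝ), (17307 / 15625 : ℝ) ≤ r → r ≤ 89409 / 80000 → IsMonatomicProfile r W S → OrigProfileEqs r W S → CavityTube r W S → CentreContent r W S := by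
  intro hbulk r W S hr₁ hr₂ hP _hE hT
  refine centreContent_of_bulk_ratio r W S hP hT (fun Λ ŵ ŝ hm hre _ him => ?_)
  have h3 : Λ.re ≤ 3 := realBound_three r W S Λ ŵ ŝ hP hT hm
  have htop : (1000 : ℝ) < |Λ.im| := by simpa [boxTop] using him
  have hL : 1000 ≤ ‖Λ‖ := le_trans htop.le (Complex.abs_im_le_norm Λ)
  exact hbulk r W S Λ ŵ ŝ hr₁ hr₂ hP hT hm hre h3 him
    (centre_inner_standing_wave r W S Λ ŵ ŝ hr₁ hr₂ hP hT hm hre h3 hL)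

end Summit.AtomisticToContinuum.HydrodynamicLimit.Theorems.SonicCavityRenewal

end
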